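import Summits.ValiantsHypothesis.ValiantsHypothesis.Theorems.BarrierLeverChowBenchmarkPairsBlockPeelWindow
import Summits.ValiantsHypothesis.ValiantsHypothesis.Theorems.BarrierLeverPartitionMinorsMooreBenchLead

/-!
# Route BarrierLever — item 22038 `ChowBenchmarkPairs`, line `moore-peel`: the BLOCK PEEL, V — STAGE
# REDUCTION II (recombination of the block rows by `adj J^κ(i,t)`, of the external pair rows by the adjugate of
# the weighted Vandermonde matrix of the ratios, and the leading coefficients)

Helper file (`--supports stmt-ValiantsHypothesis-22038`; cell valiant-natproofs, rung V4, 𝒟-side benchmark of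
record, line `moore_peel`, planner kernel target **K1** (HOME/STATUS.md l.1746); seat val-np-p4 gen 29).
Closes NO item; definition-free.  The `t`-point verbatim analogue of `…KernelPeelLead` (memo
`HOME/val-np-p4/g28/memo/MEMO-valnp4-g28.md` §1: group `S' = ∅` = the multi-window `[c_i, c_{i+t})` recombined
by `adj J(i,t)` — leading vectors `det J · e_{c_i + pos ρ}`; groups `S' = {c}` = the new attached rows
`(T_{i+s'}, {c})`, `s' < t`, separated by `adj V` of the weighted Vandermonde `V` of `…BlockPeelWindow` — leading
vectors `det V · (T_{i+s'}, {c})`; then the leading-coefficient criterion `linearIndependent_of_coeff`).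

* **`linearIndependent_kblockReducedRow`** — if `κ` has no zero, `n + t ≤ h`, the rows alive at stage `(i+t, n)`
  are linearly independent over `A = MvPolynomial (Fin h) ℂ` and `det J^κ(i,t)(X_n, …, X_{n+t-1}) ≠ 0`, then the
  reduced rows at stage `(i, n+t)` (`kblockReducedRow`, file `…BlockPeelLabels`) are linearly independent over
  `A[X]`.

WHAT THIS IS NOT: no stub of line `moore_peel` is closed; `stub_segmentMeanValue` (∀ h) is untouched; nothing
on crux stmt-ValiantsHypothesis-14610 or on `VP` versus `VNP`.
-/

set_option linter.dupNamespace false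

namespace Summit.ValiantsHypothesis.ValiantsHypothesis.Theorems.BarrierLever.MoorePeel

open Polynomial Finset


/-! ## 6. Stage reduction II -/

/-- **STAGE REDUCTION II** (block peel).  If `κ` has no zero, `n + t ≤ h`, the rows alive at stage `(i+t, n)`
are linearly independent over `MvPolynomial (Fin h) ℂ` and `det J^κ(i,t)(X_n,…,X_{n+t-1}) ≠ 0`, then the
reduced rows at stage `(i, n+t)` are linearly independent over `(MvPolynomial (Fin h) ℂ)[X]`. -/
theorem linearIndependent_kblockReducedRow (κ : ℕ → ℕ) (hκ : ∀ k, κ k ≠ 0) (h i n t r : ℕ) (hnt : n + t ≤ h)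
    (hJ : (blockMatrix κ i t (fun s : Fin t => nodeY h (n + (s : ℕ)))).det ≠ 0)
    (IH : LinearIndependent (MvPolynomial (Fin h) ℂ)
      (fun y : ↥(stageRows (i + t) n) => krow κ r (nodeY h) (y : RowLabel))) :
    LinearIndependent (Polynomial (MvPolynomial (Fin h) ℂ))
      (fun x : ↥(stageRows i (n + t)) => kblockReducedRow κ r i n (nodeY h) (x : RowLabel)) := by
  classical
  set Λ : Fin t → MvPolynomial (Fin h) ℂ := fun s => nodeY h (n + (s : ℕ)) with hΛ
  have hV : (ratioVandermonde κ i Λ).det ≠ 0 := det_ratioVandermonde_ne_zero κ hκ h i n t hnt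
  -- the three kinds of labels alive at stage `(i, n+t)`
  set ιB : BlockIdx i t → ↥(stageRows i (n + t)) := fun ρ => ⟨blockLabel i n ρ, blockLabel_mem ρ⟩ with hιB
  set ιE : Fin n × Fin t → ↥(stageRows i (n + t)) := fun cs => ⟨extLabel n cs, extLabel_mem cs⟩ with hιE
  have hιBinj : Function.Injective ιB := fun ρ ρ' e => blockLabel_injective (congrArg Subtype.val e)
  have hιEinj : Function.Injective ιE := fun cs cs' e => extLabel_injective (congrArg Subtype.val e)
  have hιBval : ∀ ρ, ((ιB ρ : ↥(stageRows i (n + t))) : RowLabel) = blockLabel i n ρ := fun ρ => rfl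
  have hιEval : ∀ cs, ((ιE cs : ↥(stageRows i (n + t))) : RowLabel) = extLabel n cs := fun cs => rfl
  have htri : ∀ x : ↥(stageRows i (n + t)), (x : RowLabel) ∈ stageRows i n ∨
      (∃ ρ, x = ιB ρ) ∨ (∃ cs, x = ιE cs) := by
    rintro ⟨x, hx⟩
    rcases stageRows_trichotomy x hx with h | ⟨ρ, rfl⟩ | ⟨cs, rfl⟩
    · exact Or.inl h
    · exact Or.inr (Or.inl ⟨ρ, rfl⟩)
    · exact Or.inr (Or.inr ⟨cs, rfl⟩)
  have hιB_not_fixed : ∀ ρ, ((ιB ρ : ↥(stageRows i (n + t))) : RowLabel) ∉ stageRows i n :=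
    fun ρ => blockLabel_not_mem ρ
  have hιE_not_fixed : ∀ cs, ((ιE cs : ↥(stageRows i (n + t))) : RowLabel) ∉ stageRows i n :=
    fun cs => extLabel_not_mem cs
  have hιE_not_rangeB : ∀ cs, ιE cs ∉ Set.range ιB := by
    rintro cs ⟨ρ, e⟩
    exact extLabel_ne_blockLabel cs ρ (congrArg Subtype.val e).symm
  have hιB_not_rangeE : ∀ ρ, ιB ρ ∉ Set.range ιE := by
    rintro ρ ⟨cs, e⟩
    exact extLabel_ne_blockLabel cs ρ (congrArg Subtype.val e)
  have hfixed_not_rangeB : ∀ x : ↥(stageRows i (n + t)), (x : RowLabel) ∈ stageRows i n →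
      x ∉ Set.range ιB := by
    rintro x hx ⟨ρ, rfl⟩
    exact hιB_not_fixed ρ hx
  have hfixed_not_rangeE : ∀ x : ↥(stageRows i (n + t)), (x : RowLabel) ∈ stageRows i n →
      x ∉ Set.range ιE := by
    rintro x hx ⟨cs, rfl⟩
    exact hιE_not_fixed cs hx
  -- the reduced rows and their closed forms
  set V2 : ↥(stageRows i (n + t)) → Fin r → (MvPolynomial (Fin h) ℂ)[X] :=
    fun x => kblockReducedRow κ r i n (nodeY h) (x : RowLabel) with hV2def
  have hV2fixed : ∀ x : ↥(stageRows i (n + t)), (x : RowLabel) ∈ stageRows i n →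
      V2 x = fun col => Polynomial.C (krow κ r (nodeY h) (x : RowLabel) col) :=
    fun x hx => kblockReducedRow_of_mem κ r i n (nodeY h) _ hx
  have hV2B : ∀ ρ : BlockIdx i t, V2 (ιB ρ) = fun col : Fin r =>
      if (col : ℕ) < windowStart i then 0 else Polynomial.C (blockEntry κ i Λ ρ (col : ℕ)) * X ^ (col : ℕ) :=
    fun ρ => kblockReducedRow_blockLabel κ r i n (nodeY h) ρ
  have hV2E : ∀ cs : Fin n × Fin t, V2 (ιE cs) = fun col : Fin r =>
      ∑ d ∈ (bits (col : ℕ)).powerset.filter (fun d => i ≤ bin d),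
        Polynomial.C ((((κ (bits (col : ℕ) \ d).card : ℕ) : MvPolynomial (Fin h) ℂ)) * nodeY h (cs.1 : ℕ) ^ bin (bits (col : ℕ) \ d) *
          (((κ d.card : ℕ) : MvPolynomial (Fin h) ℂ) * Λ cs.2 ^ bin d)) * X ^ bin d :=
    fun cs => kblockReducedRow_extLabel κ r i n (nodeY h) cs
  show LinearIndependent (MvPolynomial (Fin h) ℂ)[X] V2
  -- STEP 3a: recombine the block rows by `adj J`
  obtain ⟨V3, hV3⟩ : ∃ V3 : ↥(stageRows i (n + t)) → Fin r → (MvPolynomial (Fin h) ℂ)[X], ∀ x, V3 x =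
      if hx : ∃ ρ', ιB ρ' = x then
        ∑ ρ, (Polynomial.C ((blockMatrix κ i t Λ).adjugate (Classical.choose hx) ρ)) • V2 (ιB ρ)
      else V2 x := ⟨_, fun _ => rfl⟩
  have hV3B : ∀ ρ', V3 (ιB ρ') = ∑ ρ, (Polynomial.C ((blockMatrix κ i t Λ).adjugate ρ' ρ)) • V2 (ιB ρ) := by
    intro ρ'
    have hx : ∃ ρ, ιB ρ = ιB ρ' := ⟨ρ', rfl⟩
    rw [hV3, dif_pos hx, hιBinj (Classical.choose_spec hx)]
  have hV3off : ∀ x, x ∉ Set.range ιB → V3 x = V2 x := fun x hx => by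
    rw [hV3, dif_neg (fun ⟨ρ, e⟩ => hx ⟨ρ, e⟩)]
  apply linearIndependent_of_block' V2 V3 ιB hιBinj ((blockMatrix κ i t Λ).adjugate.map Polynomial.C) ((blockMatrix κ i t Λ).map Polynomial.C)
    (Polynomial.C (blockMatrix κ i t Λ).det)
    (fun x hx => (mul_eq_zero.mp hx).resolve_left (mt Polynomial.C_eq_zero.mp hJ))
    (by
      rw [← Matrix.map_mul, Matrix.mul_adjugate]
      ext a b
      simp only [Matrix.map_apply, Matrix.smul_apply, Matrix.one_apply, smul_eq_mul, mul_ite, mul_one,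
        mul_zero]
      split_ifs <;> simp)
    (fun ρ' => by rw [hV3B]; rfl) hV3off
  -- closed form of the recombined block rows
  have hK : ∀ (ρ' : BlockIdx i t) (col : Fin r), V3 (ιB ρ') col =
      if (col : ℕ) < windowStart i then 0 else
        Polynomial.C (∑ ρ, (blockMatrix κ i t Λ).adjugate ρ' ρ * blockEntry κ i Λ ρ (col : ℕ)) * X ^ (col : ℕ) := by
    intro ρ' col
    rw [hV3B, Finset.sum_apply]
    simp only [Pi.smul_apply, hV2B, smul_eq_mul]
    by_cases hlt : (col : ℕ) < windowStart i
    · simp [hlt]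
    · simp only [hlt, if_false]
      rw [map_sum, Finset.sum_mul]
      refine Finset.sum_congr rfl fun ρ _ => ?_
      rw [map_mul]
      ring
  -- STEP 3b: recombine the external rows by `1 ⊗ adj V`
  obtain ⟨V4, hV4⟩ : ∃ V4 : ↥(stageRows i (n + t)) → Fin r → (MvPolynomial (Fin h) ℂ)[X], ∀ x, V4 x =
      if hx : ∃ cs', ιE cs' = x then
        ∑ cs : Fin n × Fin t, (if (Classical.choose hx).1 = cs.1 then
          Polynomial.C ((ratioVandermonde κ i Λ).adjugate (Classical.choose hx).2 cs.2) else 0) • V3 (ιE cs)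
      else V3 x := ⟨_, fun _ => rfl⟩
  have hV4E : ∀ cs', V4 (ιE cs') = ∑ cs : Fin n × Fin t,
      (if cs'.1 = cs.1 then Polynomial.C ((ratioVandermonde κ i Λ).adjugate cs'.2 cs.2) else 0) • V3 (ιE cs) := by
    intro cs'
    have hx : ∃ cs, ιE cs = ιE cs' := ⟨cs', rfl⟩
    rw [hV4, dif_pos hx, hιEinj (Classical.choose_spec hx)]
  have hV4off : ∀ x, x ∉ Set.range ιE → V4 x = V3 x := fun x hx => by
    rw [hV4, dif_neg (fun ⟨cs, e⟩ => hx ⟨cs, e⟩)]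
  apply linearIndependent_of_block' V3 V4 ιE hιEinj
    (Matrix.of fun cs' cs : Fin n × Fin t =>
      if cs'.1 = cs.1 then Polynomial.C ((ratioVandermonde κ i Λ).adjugate cs'.2 cs.2) else 0)
    (Matrix.of fun cs cs' : Fin n × Fin t => if cs.1 = cs'.1 then Polynomial.C (ratioVandermonde κ i Λ cs.2 cs'.2) else 0)
    (Polynomial.C (ratioVandermonde κ i Λ).det)
    (fun x hx => (mul_eq_zero.mp hx).resolve_left (mt Polynomial.C_eq_zero.mp hV))
    (kronecker_adjugate_cancel Polynomial.C (ratioVandermonde κ i Λ))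
    (fun cs' => by rw [hV4E]; rfl) hV4off
  -- closed forms after both recombinations
  have hV4B : ∀ ρ', V4 (ιB ρ') = V3 (ιB ρ') := fun ρ' => hV4off _ (hιB_not_rangeE ρ')
  have hV3E : ∀ cs, V3 (ιE cs) = V2 (ιE cs) := fun cs => hV3off _ (hιE_not_rangeB cs)
  have hV4fixed : ∀ x : ↥(stageRows i (n + t)), (x : RowLabel) ∈ stageRows i n →
      V4 x = fun col => Polynomial.C (krow κ r (nodeY h) (x : RowLabel) col) := fun x hx => by
    rw [hV4off x (hfixed_not_rangeE x hx), hV3off x (hfixed_not_rangeB x hx), hV2fixed x hx]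
  -- coefficients of the recombined external rows
  have hV4Ecol : ∀ (cs' : Fin n × Fin t) (col : Fin r), V4 (ιE cs') col =
      ∑ s : Fin t, Polynomial.C ((ratioVandermonde κ i Λ).adjugate cs'.2 s) * V3 (ιE (cs'.1, s)) col := by
    intro cs' col
    rw [hV4E, Finset.sum_apply, Fintype.sum_prod_type,
      Finset.sum_eq_single cs'.1 (fun c _ hc => ?_) (fun hh => absurd (Finset.mem_univ _) hh)]
    · refine Finset.sum_congr rfl fun s _ => ?_
      rw [Pi.smul_apply, smul_eq_mul, if_pos (show cs'.1 = ((cs'.1, s) : Fin n × Fin t).1 from rfl)]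
    · refine Finset.sum_eq_zero fun s _ => ?_
      rw [Pi.smul_apply, if_neg (fun e : cs'.1 = ((c, s) : Fin n × Fin t).1 => hc e.symm), zero_smul]
  have hcoefE : ∀ (cs' : Fin n × Fin t) (col : Fin r) (e' : ℕ), (V4 (ιE cs') col).coeff e' =
      if bits e' ⊆ bits (col : ℕ) ∧ i ≤ e' then
        (((κ (bits (col : ℕ) \ bits e').card : ℕ) : MvPolynomial (Fin h) ℂ)) *
          nodeY h (cs'.1 : ℕ) ^ bin (bits (col : ℕ) \ bits e') *
          ∑ s : Fin t, (ratioVandermonde κ i Λ).adjugate cs'.2 s *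
            (((κ (bits e').card : ℕ) : MvPolynomial (Fin h) ℂ) * Λ s ^ e')
      else 0 := by
    intro cs' col e'
    rw [hV4Ecol, Polynomial.finsetSum_coeff]
    have hterm : ∀ s : Fin t,
        (Polynomial.C ((ratioVandermonde κ i Λ).adjugate cs'.2 s) * V3 (ιE (cs'.1, s)) col).coeff e' =
        (ratioVandermonde κ i Λ).adjugate cs'.2 s * (if bits e' ⊆ bits (col : ℕ) ∧ i ≤ e' then
          (((κ (bits (col : ℕ) \ bits e').card : ℕ) : MvPolynomial (Fin h) ℂ)) *
            nodeY h (cs'.1 : ℕ) ^ bin (bits (col : ℕ) \ bits e') *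
            (((κ (bits e').card : ℕ) : MvPolynomial (Fin h) ℂ) * Λ s ^ e') else 0) := by
      intro s
      rw [Polynomial.coeff_C_mul, hV3E, hV2E]
      dsimp only
      rw [coeff_sum_C_mul_X_pow_bin]
      simp only [Finset.mem_filter, Finset.mem_powerset, bin_bits]
    rw [Finset.sum_congr rfl fun s _ => hterm s]
    by_cases hc : bits e' ⊆ bits (col : ℕ) ∧ i ≤ e'
    · simp_rw [if_pos hc]
      rw [Finset.mul_sum]
      refine Finset.sum_congr rfl fun s _ => ?_
      ring
    · simp_rw [if_neg hc, mul_zero, Finset.sum_const_zero]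
  have hVadj : ∀ s' s'' : Fin t, ∑ s : Fin t, (ratioVandermonde κ i Λ).adjugate s' s * (((κ (bits (i + (s'' : ℕ))).card : ℕ) : MvPolynomial (Fin h) ℂ) *
      Λ s ^ (i + (s'' : ℕ))) = if s' = s'' then (ratioVandermonde κ i Λ).det else 0 := by
    intro s' s''
    have e : ∀ s, (((κ (bits (i + (s'' : ℕ))).card : ℕ) : MvPolynomial (Fin h) ℂ) * Λ s ^ (i + (s'' : ℕ))) = ratioVandermonde κ i Λ s s'' := fun s => rfl
    simp_rw [e]
    rw [← Matrix.mul_apply, Matrix.adjugate_mul, Matrix.smul_apply, Matrix.one_apply, smul_eq_mul, mul_ite,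
      mul_one, mul_zero]
  -- STEP 4: the leading coefficients
  obtain ⟨w, hw⟩ : ∃ w : ↥(stageRows i (n + t)) → ℕ, ∀ x, w x =
      if hB : ∃ ρ', ιB ρ' = x then windowStart i + (finSigmaFinEquiv (Classical.choose hB) : ℕ)
      else if hE : ∃ cs', ιE cs' = x then i + ((Classical.choose hE).2 : ℕ) else 0 := ⟨_, fun _ => rfl⟩
  have hwB : ∀ ρ', w (ιB ρ') = windowStart i + (finSigmaFinEquiv ρ' : ℕ) := by
    intro ρ'
    have hx : ∃ ρ, ιB ρ = ιB ρ' := ⟨ρ', rfl⟩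
    rw [hw, dif_pos hx, hιBinj (Classical.choose_spec hx)]
  have hwE : ∀ cs', w (ιE cs') = i + (cs'.2 : ℕ) := by
    intro cs'
    have hx : ∃ cs, ιE cs = ιE cs' := ⟨cs', rfl⟩
    rw [hw, dif_neg (fun ⟨ρ, e⟩ => hιE_not_rangeB cs' ⟨ρ, e⟩), dif_pos hx, hιEinj (Classical.choose_spec hx)]
  have hwfixed : ∀ x : ↥(stageRows i (n + t)), (x : RowLabel) ∈ stageRows i n → w x = 0 := by
    intro x hx
    rw [hw, dif_neg (fun ⟨ρ, e⟩ => hfixed_not_rangeB x hx ⟨ρ, e⟩),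
      dif_neg (fun ⟨cs, e⟩ => hfixed_not_rangeE x hx ⟨cs, e⟩)]
  -- the relabelling into stage `(i+t, n)` and the scalars
  obtain ⟨φ, hφ⟩ : ∃ φ : ↥(stageRows i (n + t)) → RowLabel, ∀ x, φ x =
      if hB : ∃ ρ', ιB ρ' = x then Sum.inl (windowStart i + (finSigmaFinEquiv (Classical.choose hB) : ℕ))
      else if hE : ∃ cs', ιE cs' = x then
        Sum.inr (Sum.inl (i + ((Classical.choose hE).2 : ℕ), ((Classical.choose hE).1 : ℕ)))
      else (x : RowLabel) := ⟨_, fun _ => rfl⟩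
  have hφB : ∀ ρ', φ (ιB ρ') = Sum.inl (windowStart i + (finSigmaFinEquiv ρ' : ℕ)) := by
    intro ρ'
    have hx : ∃ ρ, ιB ρ = ιB ρ' := ⟨ρ', rfl⟩
    rw [hφ, dif_pos hx, hιBinj (Classical.choose_spec hx)]
  have hφE : ∀ cs', φ (ιE cs') = Sum.inr (Sum.inl (i + (cs'.2 : ℕ), (cs'.1 : ℕ))) := by
    intro cs'
    have hx : ∃ cs, ιE cs = ιE cs' := ⟨cs', rfl⟩
    rw [hφ, dif_neg (fun ⟨ρ, e⟩ => hιE_not_rangeB cs' ⟨ρ, e⟩), dif_pos hx, hιEinj (Classical.choose_spec hx)]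
  have hφfixed : ∀ x : ↥(stageRows i (n + t)), (x : RowLabel) ∈ stageRows i n → φ x = x := by
    intro x hx
    rw [hφ, dif_neg (fun ⟨ρ, e⟩ => hfixed_not_rangeB x hx ⟨ρ, e⟩),
      dif_neg (fun ⟨cs, e⟩ => hfixed_not_rangeE x hx ⟨cs, e⟩)]
  have hwindow : windowStart (i + t) = windowStart i + blockWidth i t := windowStart_add_blockWidth i t
  have hφmem : ∀ x, φ x ∈ stageRows (i + t) n := by
    intro x
    rcases htri x with hx | ⟨ρ', rfl⟩ | ⟨cs', rfl⟩
    · rw [hφfixed x hx]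
      obtain ⟨y, hy⟩ := x
      rcases y with m | ⟨j, b⟩ | ⟨b, b'⟩
      · have := inl_mem_stageRows.mp hx
        rw [inl_mem_stageRows, hwindow]
        omega
      · have := inr_inl_mem_stageRows.mp hx
        exact inr_inl_mem_stageRows.mpr ⟨by omega, this.2⟩
      · exact inr_inr_mem_stageRows.mpr (inr_inr_mem_stageRows.mp hx)
    · rw [hφB, inl_mem_stageRows, hwindow]
      have := finSigmaFinEquiv_lt_blockWidth ρ'
      omega
    · rw [hφE, inr_inl_mem_stageRows]
      exact ⟨by have := cs'.2.2; omega, cs'.1.2⟩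
  have hφinj : Function.Injective φ := by
    intro x y exy
    rcases htri x with hx | ⟨ρ', rfl⟩ | ⟨cs', rfl⟩ <;>
      rcases htri y with hy | ⟨ρ'', rfl⟩ | ⟨cs'', rfl⟩
    · rw [hφfixed x hx, hφfixed y hy] at exy
      exact Subtype.ext exy
    · rw [hφfixed x hx, hφB] at exy
      rw [exy, inl_mem_stageRows] at hx
      omega
    · rw [hφfixed x hx, hφE] at exy
      rw [exy, inr_inl_mem_stageRows] at hx
      omega
    · rw [hφfixed y hy, hφB] at exy
      rw [← exy, inl_mem_stageRows] at hy
      omega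
    · rw [hφB, hφB] at exy
      simp only [Sum.inl.injEq, add_right_inj] at exy
      rw [finSigmaFinEquiv.injective (Fin.ext exy)]
    · rw [hφB, hφE] at exy
      exact absurd exy (by simp)
    · rw [hφfixed y hy, hφE] at exy
      rw [← exy, inr_inl_mem_stageRows] at hy
      omega
    · rw [hφE, hφB] at exy
      exact absurd exy (by simp)
    · rw [hφE, hφE] at exy
      simp only [Sum.inr.injEq, Sum.inl.injEq, Prod.mk.injEq, add_right_inj] at exy
      rw [show cs' = cs'' from Prod.ext (Fin.ext exy.2) (Fin.ext exy.1)]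
  obtain ⟨sc, hsc⟩ : ∃ sc : ↥(stageRows i (n + t)) → MvPolynomial (Fin h) ℂ, ∀ x, sc x =
      if ∃ ρ', ιB ρ' = x then (blockMatrix κ i t Λ).det else if ∃ cs', ιE cs' = x then (ratioVandermonde κ i Λ).det else 1 := ⟨_, fun _ => rfl⟩
  have hscB : ∀ ρ', sc (ιB ρ') = (blockMatrix κ i t Λ).det := fun ρ' => by rw [hsc, if_pos ⟨ρ', rfl⟩]
  have hscE : ∀ cs', sc (ιE cs') = (ratioVandermonde κ i Λ).det := fun cs' => by
    rw [hsc, if_neg (fun ⟨ρ, e⟩ => hιE_not_rangeB cs' ⟨ρ, e⟩), if_pos ⟨cs', rfl⟩]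
  have hscfixed : ∀ x : ↥(stageRows i (n + t)), (x : RowLabel) ∈ stageRows i n → sc x = 1 := fun x hx => by
    rw [hsc, if_neg (fun ⟨ρ, e⟩ => hfixed_not_rangeB x hx ⟨ρ, e⟩),
      if_neg (fun ⟨cs, e⟩ => hfixed_not_rangeE x hx ⟨cs, e⟩)]
  have hsreg : ∀ x y, sc x * y = 0 → y = 0 := by
    intro x y hxy
    refine (mul_eq_zero.mp hxy).resolve_left ?_
    rcases htri x with hx | ⟨ρ', rfl⟩ | ⟨cs', rfl⟩
    · rw [hscfixed x hx]; exact one_ne_zero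
    · rw [hscB]; exact hJ
    · rw [hscE]; exact hV
  -- the leading-coefficient criterion
  apply linearIndependent_of_coeff V4 w
  · -- vanishing below the leading degree
    intro x col d hd
    rcases htri x with hx | ⟨ρ', rfl⟩ | ⟨cs', rfl⟩
    · rw [hwfixed x hx] at hd
      exact absurd hd (Nat.not_lt_zero d)
    · rw [hwB] at hd
      rw [hV4B, hK]
      by_cases hlt : (col : ℕ) < windowStart i
      · rw [if_pos hlt, Polynomial.coeff_zero]
      · rw [if_neg hlt, Polynomial.coeff_C_mul_X_pow]
        by_cases hdc : d = (col : ℕ)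
        · -- `d = col` lies in the multi-window strictly left of the position of `ρ'`
          rw [if_pos hdc]
          have hcolw : (col : ℕ) < windowStart (i + t) := by
            rw [hwindow]; have := finSigmaFinEquiv_lt_blockWidth ρ'; omega
          obtain ⟨ρ'', hρ''⟩ := exists_blockIdx_of_mem_window (not_lt.mp hlt) hcolw
          have hne : ρ' ≠ ρ'' := fun e => by rw [e] at hd; omega
          rw [hρ'', adjugate_mul_blockMatrix_window, if_neg hne]
        · rw [if_neg hdc]
    · rw [hwE] at hd
      rw [hcoefE]
      by_cases hc : bits d ⊆ bits (col : ℕ) ∧ i ≤ d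
      · rw [if_pos hc]
        have := cs'.2.2
        obtain ⟨s'', hs''⟩ : ∃ s'' : Fin t, d = i + (s'' : ℕ) :=
          ⟨⟨d - i, by omega⟩, by show d = i + (d - i); omega⟩
        subst hs''
        have hne : cs'.2 ≠ s'' := fun e => by rw [e] at hd; omega
        rw [hVadj, if_neg hne, mul_zero]
      · rw [if_neg hc]
  · -- the leading coefficient vectors are (up to the nonzero scalars `sc`) the rows alive at stage `(i+t, n)`
    have hL : (fun (x : ↥(stageRows i (n + t))) (col : Fin r) => (V4 x col).coeff (w x)) =
        fun x => sc x • (fun col => krow κ r (nodeY h) (φ x) col) := by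
      funext x
      funext col
      simp only [Pi.smul_apply, smul_eq_mul]
      rcases htri x with hx | ⟨ρ', rfl⟩ | ⟨cs', rfl⟩
      · rw [hwfixed x hx, hV4fixed x hx, Polynomial.coeff_C_zero, hφfixed x hx, hscfixed x hx, one_mul]
      · rw [hwB, hV4B, hK, hφB, hscB]
        simp only [krow]
        by_cases h2 : (col : ℕ) = windowStart i + (finSigmaFinEquiv ρ' : ℕ)
        · have hlt : ¬ (col : ℕ) < windowStart i := by omega
          rw [if_neg hlt, if_pos h2, Polynomial.coeff_C_mul_X_pow, if_pos h2.symm, h2,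
            adjugate_mul_blockMatrix_window, if_pos rfl, mul_one]
        · rw [if_neg h2, mul_zero]
          by_cases hlt : (col : ℕ) < windowStart i
          · rw [if_pos hlt, Polynomial.coeff_zero]
          · rw [if_neg hlt, Polynomial.coeff_C_mul_X_pow, if_neg (fun e => h2 e.symm)]
      · rw [hwE, hcoefE, hφE, hscE]
        simp only [krow]
        by_cases hQ : bits (i + (cs'.2 : ℕ)) ⊆ bits (col : ℕ)
        · rw [if_pos ⟨hQ, Nat.le_add_right _ _⟩, if_pos hQ, hVadj, if_pos rfl, Finset.card_sdiff_of_subset hQ]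
          ring
        · rw [if_neg (fun hP => hQ hP.1), if_neg hQ, mul_zero]
    rw [hL]
    exact linearIndependent_smul_of_regular _ sc hsreg
      (linearIndependent_comp_subtype (stageRows (i + t) n) (krow κ r (nodeY h)) φ hφmem hφinj IH)

end Summit.ValiantsHypothesis.ValiantsHypothesis.Theorems.BarrierLever.MoorePeel
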